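import Mathlib.Analysis.SpecialFunctions.Pow.Real
import Mathlib.Geometry.Euclidean.Inversion.Basic
import Literature.Probability.LatticeModels.ConformalCovariance
import HarnessLib

/-!
# The generalised free field family on `ℝ³`: Möbius covariant, non-degenerate, Gaussian (`U₄ ≡ 0`)

Topic `Probability/LatticeModels`; family `crit-ising`. The two- and four-point functions of the
generalised free (mean-field) scalar of scaling dimension `Δ`,
`S₂(a,b) = ‖a-b‖^{-2Δ}`, `S₄ = S₂S₂ + S₂S₂ + S₂S₂` (Wick), all other `S_n := 0`
(Di Francesco–Mathieu–Sénéchal 1997, §4.3.1: the form of the two-point function of a quasi-primary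
field, eq. (4.55), and free-field Wick factorisation). Proved: `gffFamily Δ` is non-degenerate
(`isNondegenerateTwoPoint_gff`), translation and rotation invariant, scale covariant AND inversion
covariant with dimension `Δ` — hence `IsMoebiusCovariant Δ (gffFamily Δ)` for EVERY real `Δ`
(`isMoebiusCovariant_gff`; the inversion step is `‖ιa-ιb‖ = ‖a-b‖/(‖a‖‖b‖)`,
`EuclideanGeometry.dist_inversion_inversion`) — and its connected four-point function vanishes
identically (`limitConnectedFour_gff`, `not_hasNontrivialU4_gff`).

Purpose: the canonical witness that clauses (i) (non-degeneracy) and (ii) (Möbius covariance, any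
`Δ > 0`, in particular inside the Ising window `[1/2, 1]`) of the conformal-limit problem on `ℤ³` do
NOT imply clause (iii) (`HasNontrivialU4`): `exists_moebius_nondegenerate_gaussian`,
`not_intrinsic_strengthening`. Companion of `modelFamily` of
`Literature.Barriers.CriticalPhenomena.BootstrapLatticeBlindness` (Möbius covariant with `U₄ ≢ 0`).
No reflection positivity is claimed or needed here (it holds for `Δ ≥ 1/2`, not formalised).

## References

* P. Di Francesco, P. Mathieu, D. Sénéchal, *Conformal Field Theory* (Springer 1997), §4.3.1
  [FrancescoMathieuSenechal1997].
-/

noncomputable section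

open EuclideanGeometry

namespace Literature.Probability.LatticeModels

/-- Two-point function of the generalised free field of dimension `Δ`. [cite: FrancescoMathieuSenechal1997, §4.3.1] -/
def gffTwo (Δ : ℝ) (a b : EuclideanSpace ℝ (Fin 3)) : ℝ := ‖a - b‖ ^ (-(2 * Δ))

/-- The generalised free family (only `n = 2, 4` populated). [cite: FrancescoMathieuSenechal1997, §4.3.1] -/
def gffFamily (Δ : ℝ) : CorrFamily 3
  | 2, x => gffTwo Δ (x 0) (x 1)
  | 4, x => gffTwo Δ (x 0) (x 1) * gffTwo Δ (x 2) (x 3) + gffTwo Δ (x 0) (x 2) * gffTwo Δ (x 1) (x 3)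
      + gffTwo Δ (x 0) (x 3) * gffTwo Δ (x 1) (x 2)
  | _, _ => 0

/-- `S₂ > 0` off the diagonal. [folklore] -/
theorem gffTwo_pos (Δ : ℝ) {a b : EuclideanSpace ℝ (Fin 3)} (h : a ≠ b) : 0 < gffTwo Δ a b :=
  Real.rpow_pos_of_pos (norm_pos_iff.2 (sub_ne_zero.2 h)) _

/-- Translation invariance of `S₂`. [folklore] -/
theorem gffTwo_add (Δ : ℝ) (a b v : EuclideanSpace ℝ (Fin 3)) :
    gffTwo Δ (a + v) (b + v) = gffTwo Δ a b := by
  simp [gffTwo, add_sub_add_right_eq_sub]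

/-- `O(3)`-invariance of `S₂`. [folklore] -/
theorem gffTwo_map (Δ : ℝ) (R : EuclideanSpace ℝ (Fin 3) ≃ₗᵢ[ℝ] EuclideanSpace ℝ (Fin 3))
    (a b : EuclideanSpace ℝ (Fin 3)) : gffTwo Δ (R a) (R b) = gffTwo Δ a b := by
  simp only [gffTwo, ← map_sub, LinearIsometryEquiv.norm_map]

/-- Scale covariance of `S₂` with dimension `Δ`. [folklore] -/
theorem gffTwo_smul (Δ : ℝ) {c : ℝ} (hc : 0 < c) (a b : EuclideanSpace ℝ (Fin 3)) :
    gffTwo Δ (c • a) (c • b) = c ^ (-(2 * Δ)) * gffTwo Δ a b := by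
  simp only [gffTwo, ← smul_sub, norm_smul, Real.norm_eq_abs, abs_of_pos hc]
  exact Real.mul_rpow hc.le (norm_nonneg _)

/-- The GFF family is non-degenerate. [folklore] -/
theorem isNondegenerateTwoPoint_gff (Δ : ℝ) : IsNondegenerateTwoPoint (gffFamily Δ) := by
  intro x hx
  have hinj : Function.Injective x := hx
  have h01 : x 0 ≠ x 1 := fun h => absurd (hinj h) (by decide)
  exact gffTwo_pos Δ h01

/-- … translation invariant. [folklore] -/
theorem isTranslationInvariant_gff (Δ : ℝ) : IsTranslationInvariant (gffFamily Δ) := by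
  intro n v x
  match n with
  | 0 => rfl
  | 1 => rfl
  | 2 => simp [gffFamily, gffTwo_add]
  | 3 => rfl
  | 4 => simp [gffFamily, gffTwo_add]
  | _ + 5 => rfl

/-- … rotation invariant. [folklore] -/
theorem isRotationInvariant_gff (Δ : ℝ) : IsRotationInvariant (gffFamily Δ) := by
  intro n R x
  match n with
  | 0 => rfl
  | 1 => rfl
  | 2 => simp [gffFamily, gffTwo_map]
  | 3 => rfl
  | 4 => simp [gffFamily, gffTwo_map]
  | _ + 5 => rfl

/-- … scale covariant with dimension `Δ`. [folklore] -/
theorem isScaleCovariant_gff (Δ : ℝ) : IsScaleCovariant Δ (gffFamily Δ) := by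
  intro n c hc x
  match n with
  | 0 => simp [gffFamily]
  | 1 => simp [gffFamily]
  | 2 =>
    simp only [gffFamily, gffTwo_smul Δ hc]
    norm_num
  | 3 => simp [gffFamily]
  | 4 =>
    simp only [gffFamily, gffTwo_smul Δ hc]
    have h4 : c ^ (-((4 : ℕ) : ℝ) * Δ) = c ^ (-(2 * Δ)) * c ^ (-(2 * Δ)) := by
      rw [← Real.rpow_add hc]; norm_num; ring_nf
    rw [h4]; ring
  | _ + 5 => simp [gffFamily]

/-- … Euclidean invariant. [folklore] -/
theorem isEuclideanInvariant_gff (Δ : ℝ) : IsEuclideanInvariant (gffFamily Δ) :=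
  ⟨isTranslationInvariant_gff Δ, isRotationInvariant_gff Δ⟩

/-- The GFF two-point function under the unit inversion `ι`: `‖ιa - ιb‖ = ‖a-b‖/(‖a‖‖b‖)`
(`EuclideanGeometry.dist_inversion_inversion`), so `S₂(ιa, ιb) = ‖a‖^{2Δ}‖b‖^{2Δ} S₂(a,b)`.
[cite: FrancescoMathieuSenechal1997, §4.1 eq. (4.15)] -/
theorem gffTwo_inversion (Δ : ℝ) {a b : EuclideanSpace ℝ (Fin 3)} (ha : a ≠ 0) (hb : b ≠ 0) :
    gffTwo Δ (inversion 0 1 a) (inversion 0 1 b) = ‖a‖ ^ (2 * Δ) * ‖b‖ ^ (2 * Δ) * gffTwo Δ a b := by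
  simp only [gffTwo]
  rw [← dist_eq_norm (inversion 0 1 a), dist_inversion_inversion ha hb, one_pow, dist_zero_right,
    dist_zero_right, dist_eq_norm]
  have hab : 0 ≤ ‖a‖ * ‖b‖ := by positivity
  rw [Real.mul_rpow (by positivity) (norm_nonneg _), one_div, Real.inv_rpow hab, Real.rpow_neg hab,
    inv_inv, Real.mul_rpow (norm_nonneg _) (norm_nonneg _)]

/-- … inversion covariant with dimension `Δ`. [folklore] -/
theorem isInversionCovariant_gff (Δ : ℝ) : IsInversionCovariant Δ (gffFamily Δ) := by
  intro n x hx
  match n with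
  | 0 => simp [gffFamily]
  | 1 => simp [gffFamily]
  | 2 =>
    simp only [gffFamily, gffTwo_inversion Δ (hx 0) (hx 1), Fin.prod_univ_two]
  | 3 => simp [gffFamily]
  | 4 =>
    simp only [gffFamily, gffTwo_inversion Δ (hx _) (hx _), Fin.prod_univ_four]
    ring
  | _ + 5 => simp [gffFamily]

/-- … hence Möbius covariant with dimension `Δ`. [folklore] -/
theorem isMoebiusCovariant_gff (Δ : ℝ) : IsMoebiusCovariant Δ (gffFamily Δ) :=
  ⟨isEuclideanInvariant_gff Δ, isScaleCovariant_gff Δ, isInversionCovariant_gff Δ⟩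

/-- … and Gaussian at order four: `U₄ ≡ 0` (everywhere, coincident or not). [folklore] -/
theorem limitConnectedFour_gff (Δ : ℝ) (x : Fin 4 → EuclideanSpace ℝ (Fin 3)) :
    limitConnectedFour (gffFamily Δ) x = 0 := by
  simp [limitConnectedFour, gffFamily]

/-- The GFF family fails `HasNontrivialU4`. [folklore] -/
theorem not_hasNontrivialU4_gff (Δ : ℝ) : ¬ HasNontrivialU4 (gffFamily Δ) := by
  rintro ⟨x, -, hne⟩
  exact hne (limitConnectedFour_gff Δ x)

/-- **Strengthening refuted — no intrinsic route**: it is FALSE that every non-degenerate, Möbius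
covariant (dimension `Δ`, even inside the Ising window `Δ ∈ [1/2, 1]`) family on `ℝ³` has `U₄ ≢ 0`;
witness the generalised free field with `Δ = 1/2 + 1/50` (`≈ Δ_σ` of the 3D Ising CFT). Dropping the lattice-limit hypothesis in favour of ANY list of covariance/positivity properties of
`S` kills the crux. [cite: FrancescoMathieuSenechal1997, §4.3.1] -/
theorem not_intrinsic_strengthening :
    ¬ ∀ (Δ : ℝ) (S : CorrFamily 3), 1/2 ≤ Δ → Δ ≤ 1 → IsNondegenerateTwoPoint S →
      IsMoebiusCovariant Δ S → HasNontrivialU4 S := fun h =>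
  not_hasNontrivialU4_gff (1/2 + 1/50)
    (h _ _ (by norm_num) (by norm_num) (isNondegenerateTwoPoint_gff _) (isMoebiusCovariant_gff _))

/-- In the vocabulary of the conjunct: clauses (i) + (ii) of `CritIsing3DConformalLimit` (non-degenerate,
Möbius covariant with `Δ > 0`) do not imply clause (iii) (`HasNontrivialU4`). [cite: FrancescoMathieuSenechal1997, §4.3.1] -/
theorem exists_moebius_nondegenerate_gaussian :
    ∃ (Δ : ℝ) (S : CorrFamily 3), 0 < Δ ∧ IsNondegenerateTwoPoint S ∧ IsMoebiusCovariant Δ S ∧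
      ¬ HasNontrivialU4 S :=
  ⟨1/2 + 1/50, gffFamily _, by norm_num, isNondegenerateTwoPoint_gff _, isMoebiusCovariant_gff _,
    not_hasNontrivialU4_gff _⟩

end Literature.Probability.LatticeModels

end
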